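import Summits.BirchSwinnertonDyer.BirchSwinnertonDyer.Theorems.ThetaPartnerAtTwoSignedControlAtTwoStubPlusHondaSystemTwo
import HarnessLib

/-!
# K2r0 `SignedMainConjectureCMTwoRankZero` (stmt-BirchSwinnertonDyer-20312), line `rankzero`: the registered stub
# `stub_plusHondaSystemCMTwo` (HONDA⁺@2 read for the CM row) PROVED — the plus Honda system at `2` does not see CM

Route `ThetaPartnerAtTwo` (TP2), crux K2r0 (lead `prover-bsd-wall-tp2-p2`), skeleton `Cruxes/SignedMainConjectureCMTwoRankZero/Lines/rankzero.lean`;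
seat `prover-bsd-wall-tp2-p3-w2` (width seat 2/3 on K4, g2). The K4 theorem `SignedEC.PlusLayer.plusHondaSystemTwo_padic`
(`…StubPlusHondaSystemTwo`, p591589: the four clauses (L) (TR) (GEN) (NONDIV) at the model `ℚ_[2]`, every `ι`) uses only `W` globally
minimal, `GoodSS W 2` and `a₂(W) = 0` — no CM / rank / analytic hypothesis — so w3's transport
`SignedEC.plusHondaSystem_adicCompletion_of_padic_nonDiv` gives the CM-row statement verbatim.
HONEST FRAMING: THEOREMS ONLY; closes the stub `stub_plusHondaSystemCMTwo` of 20312's registered skeleton and nothing else; BSD is not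
proved by any of this. [cite: Kobayashi2003, Lemma 8.9, Prop. 8.11, Prop. 8.12] [cite: Sprung2012, Thm. 2.2 (2′)] [cite: KuriharaOtsuki2006, p. 557]
-/

set_option autoImplicit false
-- the Theorems namespace of this sub repeats the summit name by design (D-0017 nested layout)
set_option linter.dupNamespace false

noncomputable section

open scoped NumberField

namespace Summit.BirchSwinnertonDyer.BirchSwinnertonDyer.Theorems.SignedEC.PlusLayer

open NumberField IsDedekindDomain WeierstrassCurve Literature.NumberTheory.EllipticCurves
  Literature.NumberTheory.EllipticCurves.Kobayashi2003 Literature.NumberTheory.EllipticCurves.Rank1Residual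

/-- **HONDA⁺@2 over `ℚ_v` (`v ∋ 2`, `closureEmb`) for EVERY globally minimal `W/ℚ` with `GoodSS W 2` and `a₂(W) = 0`** — no CM, rank or
analytic-rank hypothesis: the four clauses (L) (TR) (GEN) (GEN₀) of the K4/K2r0 stubs. [cite: Kobayashi2003, §8.4 (Lemma 8.9, Props. 8.11, 8.12)]
[cite: Sprung2012, Thm. 2.2 (2′)] -/
theorem plusHondaSystemTwo_adicCompletion (W : WeierstrassCurve ℚ) [W.IsElliptic] [W.IsGloballyMinimal]
    (hss : GoodSS W 2) (ha : W.frobeniusTrace 2 = 0) (κ : ZpExtension ℚ 2) (hκ : κ.IsCyclotomic)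
    (v : HeightOneSpectrum (𝓞 ℚ)) (hv : (2 : 𝓞 ℚ) ∈ v.asIdeal) :
    ∃ d : ℕ → localPoints W (v.adicCompletion ℚ),
      (∀ m, d m ∈ localLayerPointsOfEmb κ (closureEmb (K := ℚ) (v.adicCompletion ℚ)) W m) ∧
      (∀ m, localTraceOfEmb κ (closureEmb (K := ℚ) (v.adicCompletion ℚ)) W (m + 1) (m + 2) (d (m + 2)) = -d m) ∧
      (∀ m : ℕ, 1 ≤ m → ∀ P ∈ localLayerPointsOfEmb κ (closureEmb (K := ℚ) (v.adicCompletion ℚ)) W m,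
        ∃ B ∈ AddSubgroup.closure (Set.range fun σ : Field.absoluteGaloisGroup (v.adicCompletion ℚ) ↦ σ • d m),
          ∃ P' ∈ localLayerPointsOfEmb κ (closureEmb (K := ℚ) (v.adicCompletion ℚ)) W (m - 1),
          ∃ R ∈ localLayerPointsOfEmb κ (closureEmb (K := ℚ) (v.adicCompletion ℚ)) W m, P = B + P' + 2 • R) ∧
      (∀ P ∈ localLayerPointsOfEmb κ (closureEmb (K := ℚ) (v.adicCompletion ℚ)) W 0,
        ∃ a : ℤ, ∃ R ∈ localLayerPointsOfEmb κ (closureEmb (K := ℚ) (v.adicCompletion ℚ)) W 0, P = a • d 0 + 2 • R) :=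
  Summit.BirchSwinnertonDyer.BirchSwinnertonDyer.Theorems.SignedEC.plusHondaSystem_adicCompletion_of_padic_nonDiv W hss κ v hv
    fun ι ↦ plusHondaSystemTwo_padic W hss ha κ hκ ι

end Summit.BirchSwinnertonDyer.BirchSwinnertonDyer.Theorems.SignedEC.PlusLayer

namespace Summit.BirchSwinnertonDyer.BirchSwinnertonDyer.Cruxes.SignedMainConjectureCMTwoRankZero.RankZero

open scoped NumberField
open NumberField IsDedekindDomain WeierstrassCurve Literature.NumberTheory.EllipticCurves
  Literature.NumberTheory.EllipticCurves.Kobayashi2003 Literature.NumberTheory.EllipticCurves.Rank1Residual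

/-- **The registered stub `stub_plusHondaSystemCMTwo` of line `rankzero` of K2r0 `SignedMainConjectureCMTwoRankZero`
(stmt-BirchSwinnertonDyer-20312), PROVED** — verbatim signature (HONDA⁺@2 for the CM partner `A`; the CM and rank hypotheses are not
used): `SignedEC.PlusLayer.plusHondaSystemTwo_adicCompletion`. [cite: Kobayashi2003, Lemma 8.9, Prop. 8.11, Prop. 8.12 (pp. 16–18)]
[cite: Sprung2012, Thm. 2.2 (p. 1487)] [cite: KuriharaOtsuki2006, p. 557] -/
theorem stub_plusHondaSystemCMTwo :
    ∀ (A : WeierstrassCurve ℚ) [A.IsElliptic] [A.IsGloballyMinimal],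
      A.HasCM → A.analyticRank = 0 → GoodSS A 2 → A.frobeniusTrace 2 = 0 →
      ∀ (κ : ZpExtension ℚ 2), κ.IsCyclotomic →
      ∀ (v : HeightOneSpectrum (𝓞 ℚ)), (2 : 𝓞 ℚ) ∈ v.asIdeal →
      ∃ d : ℕ → localPoints A (v.adicCompletion ℚ),
        (∀ m, d m ∈ localLayerPointsOfEmb κ (closureEmb (K := ℚ) (v.adicCompletion ℚ)) A m) ∧
        (∀ m, localTraceOfEmb κ (closureEmb (K := ℚ) (v.adicCompletion ℚ)) A (m + 1) (m + 2) (d (m + 2)) = -d m) ∧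
        (∀ m : ℕ, 1 ≤ m → ∀ P ∈ localLayerPointsOfEmb κ (closureEmb (K := ℚ) (v.adicCompletion ℚ)) A m,
          ∃ B ∈ AddSubgroup.closure (Set.range fun σ : Field.absoluteGaloisGroup (v.adicCompletion ℚ) ↦ σ • d m),
            ∃ P' ∈ localLayerPointsOfEmb κ (closureEmb (K := ℚ) (v.adicCompletion ℚ)) A (m - 1),
            ∃ R ∈ localLayerPointsOfEmb κ (closureEmb (K := ℚ) (v.adicCompletion ℚ)) A m, P = B + P' + 2 • R) ∧
        (∀ P ∈ localLayerPointsOfEmb κ (closureEmb (K := ℚ) (v.adicCompletion ℚ)) A 0,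
          ∃ a : ℤ, ∃ R ∈ localLayerPointsOfEmb κ (closureEmb (K := ℚ) (v.adicCompletion ℚ)) A 0, P = a • d 0 + 2 • R) :=
  fun A _ _ _ _ hss ha κ hκ v hv ↦
    Summit.BirchSwinnertonDyer.BirchSwinnertonDyer.Theorems.SignedEC.PlusLayer.plusHondaSystemTwo_adicCompletion A hss ha κ hκ v hv

end Summit.BirchSwinnertonDyer.BirchSwinnertonDyer.Cruxes.SignedMainConjectureCMTwoRankZero.RankZero

end
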